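import Summits.QuantumFields.YangMills.Theorems.BalabanUVNodesK0AxJoinResidualBoxUk8
import Summits.QuantumFields.YangMills.Theorems.BalabanUVNodesK0PlaquetteClassSlotsOfTexts
import Summits.QuantumFields.YangMills.Theorems.BalabanUVNodesN07DirectMethodInduction
import Summits.QuantumFields.YangMills.Theorems.BalabanUVNodesN09BackgroundRadiiTransfer

/-!
# P3 g93 №23 — (R-Uk⁸) ACROSS THE CLASS GAP: ⁸'s frozen antecedent (11) over the PLAQUETTE class ⟸ N12's [15] Thm 1 E∕U text at the stub-1 letters ∧ ONE a-priori-estimate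
# receipt for minimisers over the CLOSED plaquette class — (R-Uk⁸) ⟸ (R-EU⁸) ∧ (R-Reḡ⁸), and the box-road doors re-keyed (LENS P3 «weaken the target»; a receipt SWAP, not a weakening)

LANDING NOTE (porter ▶ PTC-1 g4, 2026-08-31; AUTHORSHIP = ★ P3 g93 «weaken the target», HOME sketch `nodeO-cover/P3-probe23-Uk8OfEUReg-v1.lean` sha16 4c44cecfd73a228c · 312 l. · 3 thm, no def, 0
sorry (№23, director-ym g23 №593 (4) (b) GO: theorem bytes = the located probe `nodeO-cover/P3-g93-located-Uk8OfEUReg-v2.lean` a6d3a58c1d9dba48 l.18–268, module docstring rewritten to landing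
grade; CONTENT: (R-Uk⁸) ⟸ (R-EU⁸) ∧ (R-Reḡ⁸) — `residualUk8_of_residualEU8_regClosure8` delivers ✓№22's `hUk` binder VERBATIM from two PRINT-SENTENCE receipts (the class-E∕U existence-uniqueness
letter and the regularity-closure letter at the record's proved Prop. 8 letters), and the two box-road doors re-keyed: K0ᴬ ⟸ {Sig8LR4Box, (R-EU⁸), (R-Reḡ⁸), (R-Old), (R-Sch♮)} — a RECEIPT SWAP
across the class gap, NOT a weakening; G₈a-1 ELIMINATED on the box road): landed VERBATIM + this paragraph under the director's basename `…Theorems/BalabanUVNodesK0AxJoinResidualBoxUk8EU.lean` (ns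
`…Theorems.K0AxJoinResidualBoxUk8EU`) as INTENT-86; imports ✓p826761 `…K0AxJoinResidualBoxUk8` + ✓`…K0PlaquetteClassSlotsOfTexts` + ✓`…N07DirectMethodInduction` + ✓`…N09BackgroundRadiiTransfer`;
`--supports stmt-QuantumFields-27238 --as helper --cite Balaban1985Variational --cite Balaban1987RG1` (NO `--workitem`; kind proof). ◆ CRIT-1's cut: ◆ CRIT-1 g39 «(C) CUT ★ P3 №23
`…K0AxJoinResidualBoxUk8EU` (№593 (4)) — SAME-WALL: `residualUk8_of_residualEU8_regClosure8` trades ✓№22's binder (R-Uk⁸) (for which print has no verbatim sentence — gap G₈a-1) for (R-EU⁸) = N12's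
[15] Thm 1 E∕U text `VariationalThm1EUSepCoP7MG` ∧ (R-Reḡ⁸) = «every Wilson minimiser over `closure (bgReg a₀)` on the fibre of an ε₁-regular V lies in 𝔘_{k+1}(a₀)» ([15] Prop. 7 (ii)∕Sect. F
species); the proof is NOT a relabelling: existence from ✓`N07DirectMethod.exists_isBackground_closure_bgReg` ((53)-admissibility of α₀ := 2a₀ discharged numerically), regularity transport
✓`isBackground_of_isBackground_closure_of_mem` + ✓`isBackground_superset_of_exists_mem`, uniqueness from ✓`uniqueUkOrbit_of_orbitUnique_of_reg10` +
✓`exists_unique_isBackground_inUkClassB11_of_thm1EUSepCoP7MG`; J5′ (costume test): (R-Reḡ⁸) asserts neither existence nor uniqueness — a different species from (R-Uk⁸) ⇒ a RECEIPT SWAP across the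
class gap, SURVIVES priced «both receipts CONDITIONAL, Bałaban-strength, inhabited NOWHERE; G₈a-1 eliminated on the box road only»; located-A = ✓№22 :180∕:245 `hUk` binders (consumed BY NAME, all
other binders VERBATIM) ∧ located-B = [15] Prop. 7 p.299 ∕ pp.304–305 (page placement READ-NOT-VERIFIED by ◆ today); J1′: Mathlib `closure` in the product topology; `InUkClassB11` strict + clause
(10); level guards by `omega`, no ℕ-subtraction∕division junk; hypotheses consistent at the flat datum; J4 BY NAME: 3 decls + namespace → 0 tree hits; customs-before-landing: probe
`scratch/Crit1Cut23_Uk8OfEUReg_verbatim.lean` = 4c44cecf bytes ⊕ 3 guards ⇒ farm rc 0 · 0 warn · 0 sorry, 3∕3 std; audit support 1 · proof.conditional 1 · orphan 1, `closes []` ⇒ №23: GO VERBATIM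
(`--supports stmt-QuantumFields-27238 --as helper`, cites as in header)» (nodeO STATUS 2026-08-31T16:05:13Z). HONEST (porter): a composition re-keying CONDITIONAL doors on displayed receipts
(credit nothing); (R-EU⁸)∕(R-Reḡ⁸)∕(R-Old)∕(R-Sch♮) and ⁸'s box texts are OPEN Bałaban-strength content inhabited NOWHERE; nothing of Bałaban asserted, ported, discharged or refuted; K0ᴬ
stmt-QuantumFields-27238 ∕ K1ᴬ 27239 OPEN — NOTHING of them proved; NODE O 0∕1; COUNT 8∕28 · K 1∕4 UNMOVED; finite 𝕋⁴ at fixed ε — NOT continuum ∕ OS ∕ Clay; the Yang–Mills mass gap is NOT proved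
by any of this.

ym-nodeO-ideate ★ P3 g93 (count-neutral author seat; sketch OFFERED to ◆ CRIT-1 ∕ ▶ PTC-1 ∕ ▶ PTA-1 on ★★★ director-ym №593 (4) — P3 files nothing).  [15] = [Balaban1985Variational];
[I] = [Balaban1987RG1].  WHY.  After ✓№22 (`…K0AxJoinResidualBoxUk8`, ✓p826761) the box road displays K0ᴬ ⟸ {⁸ `Sig8LR4Box`, (R-Uk⁸), (R-Old), (R-Sch♮)} and the junction
`hβc` ⟸ the same ∪ {cofinal ⁸, (R-Win₁)}, where (R-Uk⁸) = [15] Thm 1 (8)–(9)'s existence ∕ unique-orbit clause `UkExists ∧ UniqueUkOrbit` for the record's one-scale problem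
[I] (1.1) over node00-def-B's PLAQUETTE-ONLY class `bgReg a₀` (`PlaqSmall (a₀η²)`; the current clause of [I] (1.2) dropped — tree divergence D-defB-1) at the record volumes
`K = recordK₀ F Mc k + n`, demanded only at the letters of the PROVED stub-1 text ([15] Prop. 8's grid-guarded top step).  Print never poses the plaquette-class problem: [15] Thm 1
speaks of the class (2) = `InUkClassB11` (plaquettes AND currents), read into the tree as N12's sentences `VariationalThm1EUSepCoP7MG` (existence ∕ uniqueness) and
`VariationalThm1RegSepCoP7MGB` (regularity (9)–(10) — at the stub-1 letters a TREE THEOREM, ✓`N07Thm1Top7FromProp8GuardedB.variationalThm1RegSepCoP7MGB_of_prop8TopStepGB_lamDatum`).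
The K0⁷ road's ✓`K0PlaquetteClassSlotsOfTexts` (n07-w3 g21, 2026-08-31) located D-defB-1's price there as {G₈a-1 (plaquette-class SOLVABILITY), (R10) (every plaquette-class
minimiser lies in `𝔘_k(ε)`)} beyond the EU text, with the uniqueness half already the EU text's (`uniqueUkOrbit_of_orbitUnique_of_reg10`).  THIS FILE crosses the class gap ON THE
BOX ROAD with ONE receipt and NO solvability receipt:
    (R-EU⁸)  := ∀ stub-1 letters `(c, c₀, c₁, B₃ ≥ 2L², aS, a₁)` at which `Prop8RegSepTopStepGB F 2 suppDom A‴(c,c₀,c₁) (lamDatum F) (dataSmall7LamTopOf F 2) B₃ aS a₁` holds,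
                `VariationalThm1EUSepCoP7MG F 2 A‴(c,c₀,c₁) B₃ aS a₁`  ([15] Thm 1 existence ∕ uniqueness AT the package's letters — the shape of its proved REG sibling);
    (R-Reḡ⁸) := at the same letters, `∃ aR > 0, ∀ a₀ ∈ ]0, aR], ∃ M₀, ∀ Mc, McGuard F Mc → M₀ ≤ Mc → ∀ ε₁ ∈ ]0, a₁], B₃ε₁ ≤ a₀ → ∀ k n V, PlaqSmall ε₁ V →
                ∀ U₃, IsBackground (avOfRecord F 2 K) (closure (bgReg F 2 K (k+1) a₀)) (k+1) V U₃ → InUkClassB11 F 2 K (k+1) a₀ U₃`  (`K := recordK₀ F Mc k + n` spelled out)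
— «every minimiser of the Wilson action over the CLOSED plaquette class on the fibre of a regular datum lies in [15] (2)'s class `𝔘_{k+1}(a₀)`»: boundary avoidance (plaquettes
`< a₀η²` STRICTLY — N07's (AV)) AND the current clause (10) ((R10)) in ONE sentence of [15] Prop. 7 (ii) ∕ Sect. F «U_k is in the space (8)» a-priori-estimate species, posed for
the closed plaquette class of record — D-defB-1's exact residue on this road.
WHAT THIS FILE PROVES.  §1 ★★ `residualUk8_of_residualEU8_regClosure8 (F)` : (R-EU⁸) F → (R-Reḡ⁸) F → (R-Uk⁸) F, the conclusion VERBATIM as ✓№22's doors read their binder `hUk`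
(ceiling `aU := min aR (min aS (min (1∕(6·143·256)) (δ_SU(2)∕(2·(8L)²))))`, floor `max M₀ᴿ L^{c₀+c₁}`).  EXISTENCE: the EU minimiser at radius `ε₀ := a₀ ≤ aS`
(✓`K0TopSocketOfThm1EUText.exists_unique_isBackground_inUkClassB11_of_thm1EUSepCoP7MG` at level `k+1 ≥ 1`; guards `k+1+c₀ ≤ m+K`, `k+1+c₁ ≤ m+K` at
`K = recordK₀ F Mc k + n = k+1+log_L Mc+n` from the floor `L^{c₀+c₁} ≤ Mc` by `Nat.le_log_of_pow_le`) lies in `𝔘(a₀) ⊆ bgReg(a₀)` (`InUkClassB11.mem_bgReg`) ⇒ the OPEN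
fibre is non-empty ⇒ N07's direct method over its closure (✓`N07DirectMethod.exists_isBackground_closure_bgReg`, `α₀ := 2a₀`, (53)-admissible at `d = 4` below the ceiling by
`T4Family.P_d ∕ P_L`) ⇒ a closed-class minimiser `U₃` ⇒ (R-Reḡ⁸): `U₃ ∈ 𝔘(a₀) ⊆ bgReg(a₀)` ⇒ `U₃` minimises over `bgReg(a₀)`
(✓`N07DirectMethodInduction.isBackground_of_isBackground_closure_of_mem`) = `UkExists`.  UNIQUENESS: every `bgReg(a₀)`-minimiser is a closure-minimiser because `U₃ ∈ bgReg(a₀)`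
competes (✓`N09BackgroundRadiiTransfer.isBackground_superset_of_exists_mem`) ⇒ lies in `𝔘(a₀)` by (R-Reḡ⁸) ⇒ w3's ✓`K0PlaquetteClassSlotsOfTexts.uniqueUkOrbit_of_orbitUnique_of_reg10`
with the EU text's orbit-uniqueness over `𝔘(a₀)` = `UniqueUkOrbit`.  So G₈a-1 and (R10) both FOLLOW from (R-EU⁸) ∧ (R-Reḡ⁸) at the record; neither is displayed.
§2 ★★★ K0ᴬ BY NAME ⟸ ⁸-on-the-box ∧ (R-EU⁸) ∧ (R-Reḡ⁸) ∧ (R-Old) ∧ (R-Sch♮) = ✓№22's `record13SepCoPHInhabitedAx_of_sig8LR4Box_uk8_old_schemeNatural` with `hUk := §1` — the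
by-name certificate that §1's conclusion IS ⁸'s frozen (11) as K0ᴬ's door reads it (the (R-Old) ∕ (R-Sch♮) binders copied VERBATIM from ✓№22 :191–:219);
§3 ★★★ the junction's binder `hβc` VERBATIM ⟸ cofinal ⁸ ∧ (R-EU⁸) ∧ (R-Reḡ⁸) ∧ (R-Old) ∧ (R-Sch♮) ∧ (R-Win₁) = ✓№22's
`cofinalBetaSocketAxBody_allRadii_of_sig8LR4BoxCofinal_uk8_old_schemeNatural_winC` likewise (binders VERBATIM from ✓№22 :256–:289).
EDGE CONTENT (LENS-P3 decision table, box road, after №23): K0ᴬ ⟸ {⁸ `Sig8LR4Box`, (R-EU⁸), (R-Reḡ⁸), (R-Old), (R-Sch♮)}; junction `hβc` ⟸ the same ∪ {cofinal ⁸, (R-Win₁)}.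
A RECEIPT SWAP ACROSS THE CLASS GAP, NOT A WEAKENING: (R-Reḡ⁸) and (R-Uk⁸) are incomparable as typed — §1 is (R-EU⁸) ∧ (R-Reḡ⁸) ⟹ (R-Uk⁸) and NO converse is claimed; what is
gained is that every K0ᴬ receipt on this road is now a PRINT SENTENCE ([15] Thm 1 E∕U at the record's letters — the N12 ∕ N07 lane's own declared target) or print's a-priori-estimate
species read for the record's class, and G₈a-1 — the one receipt with no print sentence as posed — is ELIMINATED on the box road (it FOLLOWS, above).  MEETING POINT made a theorem: the
box road's slot (11) and the K0⁷ ∕ N07 ∕ N12 lane's supplier now share BOTH the letters (✓№22) AND the class up to (R-Reḡ⁸).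

HONEST FRAMING.  CONDITIONAL doors (kernel-checked implications between DISPLAYED rows; audit support ∕ `proof.conditional` ∕ orphan exactly as ✓№22's, credits nothing); NOTHING of
Bałaban is asserted, ported, discharged or refuted; (R-EU⁸) ([15] Thm 1 existence ∕ uniqueness for levels `≥ 1` — the EU text's `k = 0` edition is refuted in the tree by the centre
twist, ✓`B15Prop1Thm1LetterLengthZero`, hence the EU socket's `1 ≤ k` guard, met here at level `k+1`), (R-Reḡ⁸), (R-Old), (R-Sch♮), (R-Win₁) and ⁸'s box texts (⟨27930⟩ 1∕3) are
OPEN Bałaban-strength content ([15] Thm 1 (6),(8)–(10), Props. 4, 6, 7, 9, (176)–(182); [I] (1.22), §1∕§5 + AF sign) inhabited NOWHERE as packages; the stub-1 text, the EU socket,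
N07's direct method, N09's radius transfer and w3's slot lemma are CITED as the tree theorems they are, not re-proved; K0ᴬ stmt-QuantumFields-27238 OPEN — NOTHING of it proved; K1ᴬ 27239 ∕
K3ᴬ 27247 ∕ ⟨27930⟩ OPEN; NODE O `B13TermWalkDataOneTorus.ExistsUniformAcrossSmall` NOT inhabited (0∕1); COUNT 8∕28 · K 1∕4 UNMOVED; finite `𝕋⁴_{L^K}` at fixed ε — NOT continuum ∕
ℝ⁴ ∕ OS; R4 = the conditional `BalabanLadder.UV` rung only; **the Yang–Mills mass gap (Clay) is NOT proved by any of this.**  No `sorry`, no `def`, no `instance`, no `notation`;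
standard axioms.

References: T. Bałaban, *The variational problem and background fields in renormalization group method for lattice gauge theories*, Comm. Math. Phys. 102 (1985) 277–309
[Balaban1985Variational] — (2), (4)–(7) p.278, Thm 1 (8)–(10) pp.278–279, Prop. 7 p.299, Sect. F pp.299–304, Prop. 8 p.304, Prop. 9 p.309, (176)–(178) p.306; T. Bałaban,
*Renormalization group approach to lattice gauge field theories. I*, Comm. Math. Phys. 109 (1987) 249–301 [Balaban1987RG1] — (0.21)–(0.22) p.256, Thm 1 p.259, Thm 2 (0.31) p.259,
(1.1)–(1.2) p.260, (1.18)–(1.22) pp.263–264, Thm 3 p.264, (5.38)–(5.44) pp.296–297; T. Bałaban, *Regularity and decay of lattice Green's functions* ∕ *Spaces of regular gauge field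
configurations on a lattice and gauge fixing conditions*, Comm. Math. Phys. 99 (1985) 75–102 [Balaban1985RegularSpaces] — Prop. 6 (1.130)–(1.138) p.99; T. Bałaban, *Propagators and
renormalization transformations for lattice gauge theories. II*, Comm. Math. Phys. 96 (1984) 223–250 [Balaban1984PropagatorsII] — (2.3) p.224.
-/

open Filter Topology
open scoped BigOperators Matrix.Norms.L2Operator
open scoped InnerProductSpace

namespace Summit.QuantumFields.YangMills.Theorems.K0AxJoinResidualBoxUk8EU

open Literature.MathematicalPhysics.QuantumFieldTheory.Balaban1983to89
open Literature.MathematicalPhysics.QuantumFieldTheory.Balaban1983to89.Node00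
open Literature.MathematicalPhysics.QuantumFieldTheory.Balaban1983to89.T4Continuum (T4Family)
open Literature.MathematicalPhysics.QuantumFieldTheory.Balaban1983to89.B12FormatPlus
open Literature.MathematicalPhysics.QuantumFieldTheory.Balaban1983to89.FlowStep
open Literature.MathematicalPhysics.QuantumFieldTheory.Balaban1983to89.FlowStepRuns
open Literature.MathematicalPhysics.QuantumFieldTheory.Balaban1983to89.ExpMeanLog (deltaSU deltaSU_pos)
open B12GaugeOrbits021 (OrbitRel)
open B11Prop6Scheme (mapT)
open B11Eq103H1Complex (BondL2K SiteL2K)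
open B11Thm1ExistsUniqueCoP7MG (VariationalThm1EUSepCoP7MG)
open NormedSpace (exp)
open Summit.QuantumFields.YangMills.Theorems
open Summit.QuantumFields.YangMills.Theorems.K0RecordFormatNames
open Summit.QuantumFields.YangMills.Theorems.K0AxMomentRoad
open Summit.QuantumFields.YangMills.Theorems.PortHRecordJoin
open Summit.QuantumFields.YangMills.Theorems.BalabanUVNodesPortS1 (Sig8LR4Box)
open Summit.QuantumFields.YangMills.Theorems.K0AxJunctionWindow (Sig8LR4BoxBelow)
open Summit.QuantumFields.YangMills.Theorems.K0AxJoinResidualBoxUk8 (record13SepCoPHInhabitedAx_of_sig8LR4Box_uk8_old_schemeNatural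
  cofinalBetaSocketAxBody_allRadii_of_sig8LR4BoxCofinal_uk8_old_schemeNatural_winC)
open Summit.QuantumFields.YangMills.BalabanUVNodes.K0TopSocketOfThm1EUText (exists_unique_isBackground_inUkClassB11_of_thm1EUSepCoP7MG)
open Summit.QuantumFields.YangMills.BalabanUVNodes.K0PlaquetteClassSlotsOfTexts (uniqueUkOrbit_of_orbitUnique_of_reg10)
open Summit.QuantumFields.YangMills.BalabanUVNodes.N07DirectMethod (exists_isBackground_closure_bgReg)
open Summit.QuantumFields.YangMills.BalabanUVNodes.N07DirectMethodInduction (isBackground_of_isBackground_closure_of_mem)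
open Summit.QuantumFields.YangMills.BalabanUVNodes.N09BackgroundRadiiTransfer (isBackground_superset_of_exists_mem)

/-! ## §1  ★★ THE DOOR: (R-Uk⁸) ⟸ (R-EU⁸) ∧ (R-Reḡ⁸) -/

/-- ★★ **(R-Uk⁸) ⟸ (R-EU⁸) ∧ (R-Reḡ⁸).**  AT ONE FAMILY `F`.  (R-EU⁸): at every stub-1 letters `(c, c₀, c₁, B₃ ≥ 2L², aS, a₁)` at which [15] Prop. 8's
grid-guarded top step over print's datum holds, N12's [15] Thm 1 E∕U sentence `VariationalThm1EUSepCoP7MG F 2 A‴(c,c₀,c₁) B₃ aS a₁`.  (R-Reḡ⁸): at the same letters, a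
radius ceiling `aR` and, per radius `a₀ ≤ aR`, a floor `M₀` such that at every record volume `K = recordK₀ F Mc k + n` (`McGuard`, `M₀ ≤ Mc`), every
`ε₁`-regular datum `V` (`0 < ε₁ ≤ a₁`, `B₃ε₁ ≤ a₀`) at level `k + 1`: EVERY minimiser of the Wilson action over the CLOSED plaquette class
`closure (bgReg a₀)` on the fibre of `V` lies in [15] (2)'s class `𝔘_{k+1}(a₀)` (plaquettes `< a₀η²` STRICTLY and the current clause (10)) — the
a-priori-estimate species of [15] Prop. 7 (ii) ∕ Sect. F «U_k is in the space (8)», posed for the closed PLAQUETTE class of record (D-defB-1).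
THEN ⁸'s antecedent (11): `UkExists ∧ UniqueUkOrbit` over `bgReg a₀` at every such datum, ceiling `aU := min aR (min aS aA)`.
Existence: the EU minimiser at radius `a₀` lies in `𝔘(a₀) ⊆ bgReg(a₀)` (non-empty open fibre) ⇒ direct method over the closure (`α₀ := 2a₀`,
(53)-admissible below `aA`) ⇒ a closed-class minimiser `U₃` ⇒ (R-Reḡ⁸) `U₃ ∈ 𝔘(a₀) ⊆ bgReg(a₀)` ⇒ `U₃` minimises over `bgReg(a₀)`.  Uniqueness: every
`bgReg(a₀)`-minimiser is a closure-minimiser (`U₃` competes) ⇒ in `𝔘(a₀)` ⇒ w3's §1 with the EU text's orbit-uniqueness at `ε₀ := a₀ ≤ aS`.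
CONDITIONAL in both receipts; nothing of Bałaban's asserted. [cite: Balaban1985Variational, Thm 1 (6),(8)–(10) pp.278–279, Prop. 7 p.299, pp.304–305;
Balaban1987RG1, (0.21) p.256, (1.1)–(1.2) p.260] -/
theorem residualUk8_of_residualEU8_regClosure8 (F : T4Family)
    (hEU8 : ∀ (c c₀ c₁ : ℕ) (B₃ aS a₁ : ℝ), 2 * (F.L : ℝ) ^ 2 ≤ B₃ → 0 < aS → 0 < a₁ →
        Prop8RegSepTopStepGB F 2 (fun ν K Ω => suppDomOfRecord F ν K Ω)
          (fun ν M g K k _s => c ≤ ν.M₁ ∧ k + c₀ ≤ F.m + K ∧ F.L ^ c₁ ∣ M ∧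
            ∀ i, 1 ≤ i → i ≤ k → dCubeSide (F.P K).L M (RkOfRecord (F.P K).L ν.r (g i)) i ∣ (F.P K).sitesPerDir 0)
          (lamDatum F) (dataSmall7LamTopOf F 2) B₃ aS a₁ →
        VariationalThm1EUSepCoP7MG F 2
          (fun ν M g K k _s => c ≤ ν.M₁ ∧ k + c₀ ≤ F.m + K ∧ F.L ^ c₁ ∣ M ∧
            ∀ i, 1 ≤ i → i ≤ k → dCubeSide (F.P K).L M (RkOfRecord (F.P K).L ν.r (g i)) i ∣ (F.P K).sitesPerDir 0) B₃ aS a₁)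
    (hReg8 : ∀ (c c₀ c₁ : ℕ) (B₃ aS a₁ : ℝ), 2 * (F.L : ℝ) ^ 2 ≤ B₃ → 0 < aS → 0 < a₁ →
        Prop8RegSepTopStepGB F 2 (fun ν K Ω => suppDomOfRecord F ν K Ω)
          (fun ν M g K k _s => c ≤ ν.M₁ ∧ k + c₀ ≤ F.m + K ∧ F.L ^ c₁ ∣ M ∧
            ∀ i, 1 ≤ i → i ≤ k → dCubeSide (F.P K).L M (RkOfRecord (F.P K).L ν.r (g i)) i ∣ (F.P K).sitesPerDir 0)
          (lamDatum F) (dataSmall7LamTopOf F 2) B₃ aS a₁ →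
        ∃ aR : ℝ, 0 < aR ∧ ∀ a₀ : ℝ, 0 < a₀ → a₀ ≤ aR → ∃ M₀ : ℕ, ∀ Mc : ℕ, McGuard F Mc → M₀ ≤ Mc →
        ∀ ε₁ : ℝ, 0 < ε₁ → ε₁ ≤ a₁ → B₃ * ε₁ ≤ a₀ → ∀ (k n : ℕ) (V : GaugeField (F.P (recordK₀ F Mc k + n)) (k + 1) (SU 2)), PlaqSmall ε₁ V →
          ∀ U₃ : GaugeField (F.P (recordK₀ F Mc k + n)) 0 (SU 2),
            IsBackground (avOfRecord F 2 (recordK₀ F Mc k + n)) (closure (bgReg F 2 (recordK₀ F Mc k + n) (k + 1) a₀)) (k + 1) V U₃ →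
            InUkClassB11 F 2 (recordK₀ F Mc k + n) (k + 1) a₀ U₃) :
    ∀ (c c₀ c₁ : ℕ) (B₃ aS a₁ : ℝ), 2 * (F.L : ℝ) ^ 2 ≤ B₃ → 0 < aS → 0 < a₁ →
        Prop8RegSepTopStepGB F 2 (fun ν K Ω => suppDomOfRecord F ν K Ω)
          (fun ν M g K k _s => c ≤ ν.M₁ ∧ k + c₀ ≤ F.m + K ∧ F.L ^ c₁ ∣ M ∧
            ∀ i, 1 ≤ i → i ≤ k → dCubeSide (F.P K).L M (RkOfRecord (F.P K).L ν.r (g i)) i ∣ (F.P K).sitesPerDir 0)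
          (lamDatum F) (dataSmall7LamTopOf F 2) B₃ aS a₁ →
        ∃ aU : ℝ, 0 < aU ∧ ∀ a₀ : ℝ, 0 < a₀ → a₀ ≤ aU → ∃ M₀ : ℕ, ∀ Mc : ℕ, McGuard F Mc → M₀ ≤ Mc →
        (∀ ε₁ : ℝ, 0 < ε₁ → ε₁ ≤ a₁ → B₃ * ε₁ ≤ a₀ → ∀ (k n : ℕ) (V : GaugeField (F.P (recordK₀ F Mc k + n)) (k + 1) (SU 2)), PlaqSmall ε₁ V →
          UkExists F 2 (recordK₀ F Mc k + n) (k + 1) a₀ V ∧ UniqueUkOrbit F 2 (recordK₀ F Mc k + n) (k + 1) a₀ V) := by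
  intro c c₀ c₁ B₃ aS a₁ hB₃ haS ha₁ h8
  have hL : (0 : ℝ) < (F.L : ℝ) := by exact_mod_cast lt_trans Nat.zero_lt_one F.hL.2
  have hBpos : (0 : ℝ) < B₃ := lt_of_lt_of_le (mul_pos two_pos (pow_pos hL 2)) hB₃
  have hEU := hEU8 c c₀ c₁ B₃ aS a₁ hB₃ haS ha₁ h8
  obtain ⟨aR, haR, hR⟩ := hReg8 c c₀ c₁ B₃ aS a₁ hB₃ haS ha₁ h8
  -- the (53)-admissibility ceiling for `α₀ := 2a₀` at `d = 4`, `L = F.L`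
  have hδ := deltaSU_pos (n := Fin 2)
  have haA : (0 : ℝ) < min (1 / (6 * (143 * 256))) (deltaSU (Fin 2) / (2 * (8 * (F.L : ℝ)) ^ 2)) :=
    lt_min (by norm_num) (div_pos hδ (by positivity))
  refine ⟨min aR (min aS (min (1 / (6 * (143 * 256))) (deltaSU (Fin 2) / (2 * (8 * (F.L : ℝ)) ^ 2)))),
    lt_min haR (lt_min haS haA), fun a₀ ha₀ ha₀le => ?_⟩
  have ha₀R : a₀ ≤ aR := ha₀le.trans (min_le_left _ _)
  have ha₀S : a₀ ≤ aS := ha₀le.trans ((min_le_right _ _).trans (min_le_left _ _))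
  have ha₀1 : a₀ ≤ 1 / (6 * (143 * 256)) := ha₀le.trans ((min_le_right _ _).trans ((min_le_right _ _).trans (min_le_left _ _)))
  have ha₀2 : a₀ ≤ deltaSU (Fin 2) / (2 * (8 * (F.L : ℝ)) ^ 2) :=
    ha₀le.trans ((min_le_right _ _).trans ((min_le_right _ _).trans (min_le_right _ _)))
  obtain ⟨M₀, hM₀⟩ := hR a₀ ha₀ ha₀R
  refine ⟨max M₀ (F.L ^ (c₀ + c₁)), fun Mc hG hMc => ?_⟩
  have hMc₀ : M₀ ≤ Mc := (le_max_left _ _).trans hMc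
  have hlog : c₀ + c₁ ≤ Nat.log F.L Mc := Nat.le_log_of_pow_le F.hL.2 ((le_max_right _ _).trans hMc)
  intro ε₁ hε₁ hε₁a hBε k n V hV
  -- level guards at `K = recordK₀ F Mc k + n = k + 1 + log_L Mc + n`
  have hK : recordK₀ F Mc k = k + 1 + Nat.log F.L Mc := rfl
  have hc₀ : k + 1 + c₀ ≤ F.m + (recordK₀ F Mc k + n) := by rw [hK]; omega
  have hc₁ : k + 1 + c₁ ≤ F.m + (recordK₀ F Mc k + n) := by rw [hK]; omega
  -- [15] Thm 1's objects at `(K, k+1)`, radius `ε₀ := a₀ ≤ aS`, datum regularity `ε₁`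
  obtain ⟨⟨U₀, hU₀⟩, huniq⟩ :=
    exists_unique_isBackground_inUkClassB11_of_thm1EUSepCoP7MG F 2 hBpos.le hEU (Nat.le_add_left 1 k) hc₀ hc₁ hε₁ hε₁a hBε ha₀S hV
  -- (53)-admissibility of `α₀ := 2a₀`
  have hα3 : (143 * (((((F.P (recordK₀ F Mc k + n)).d + 4 : ℕ) : ℝ)) ^ 2 / 4) ^ 2) * (2 * a₀) ≤ 1 / 3 := by
    simp only [T4Family.P_d]
    norm_num
    linarith
  have hα2 : 2 * (2 * a₀) ≤ 2 * deltaSU (Fin 2) / ((((F.P (recordK₀ F Mc k + n)).d + 4) * (F.P (recordK₀ F Mc k + n)).L : ℕ) : ℝ) ^ 2 := by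
    have hx : ((((F.P (recordK₀ F Mc k + n)).d + 4) * (F.P (recordK₀ F Mc k + n)).L : ℕ) : ℝ) = 8 * (F.L : ℝ) := by
      simp only [T4Family.P_d, T4Family.P_L]; push_cast; ring
    rw [hx]
    have hpos : (0 : ℝ) < (8 * (F.L : ℝ)) ^ 2 := by positivity
    have key : a₀ * (2 * (8 * (F.L : ℝ)) ^ 2) ≤ deltaSU (Fin 2) := (le_div_iff₀ (by positivity)).1 ha₀2
    rw [le_div_iff₀ hpos]
    linarith
  -- the open fibre at radius `a₀` is non-empty (the EU minimiser lies in `𝔘(a₀) ⊆ bgReg(a₀)`); direct method over the closure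
  have hne : ∃ U ∈ bgReg F 2 (recordK₀ F Mc k + n) (k + 1) a₀, Averaging.iter (avOfRecord F 2 (recordK₀ F Mc k + n)) (k + 1) U = V :=
    ⟨U₀, InUkClassB11.mem_bgReg hU₀.2.1, hU₀.1⟩
  obtain ⟨U₃, hU₃⟩ := exists_isBackground_closure_bgReg (F := F) (N := 2) (recordK₀ F Mc k + n) (k + 1)
    (show a₀ < 2 * a₀ by linarith) (by linarith) hα3 hα2 hne
  -- (R-Reḡ⁸) at this datum: closed-class minimisers lie in `𝔘(a₀)`
  have hRV := hM₀ Mc hG hMc₀ ε₁ hε₁ hε₁a hBε k n V hV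
  have h3 : InUkClassB11 F 2 (recordK₀ F Mc k + n) (k + 1) a₀ U₃ := hRV U₃ hU₃
  refine ⟨⟨U₃, isBackground_of_isBackground_closure_of_mem hU₃ (InUkClassB11.mem_bgReg h3)⟩, ?_⟩
  -- uniqueness: a `bgReg(a₀)`-minimiser is a closure-minimiser (`U₃` competes), hence in `𝔘(a₀)`; then w3's §1
  exact uniqueUkOrbit_of_orbitUnique_of_reg10 huniq fun U₁ h₁ =>
    hRV U₁ (isBackground_superset_of_exists_mem h₁ subset_closure hU₃ (InUkClassB11.mem_bgReg h3))

/-! ## §2  ★★★ K0ᴬ's DOOR RE-KEYED: K0ᴬ BY NAME ⟸ ⁸-box ∧ (R-EU⁸) ∧ (R-Reḡ⁸) ∧ (R-Old) ∧ (R-Sch♮) (✓№22 :180 with `hUk := §1`) -/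

/-- ★★★ **K0ᴬ BY NAME ⟸ ⁸-ON-THE-BOX ∧ (R-EU⁸) ∧ (R-Reḡ⁸) ∧ (R-Old) ∧ (R-Sch♮)**: ✓`record13SepCoPHInhabitedAx_of_sig8LR4Box_uk8_old_schemeNatural` with its
(R-Uk⁸) binder supplied by §1 — the by-name certificate that §1's conclusion IS ⁸'s frozen antecedent (11) as the K0ᴬ door reads it.  CONDITIONAL helper;
every displayed hypothesis OPEN Bałaban-strength content inhabited NOWHERE; K0ᴬ 27238 OPEN; the Yang–Mills mass gap is NOT proved.
[cite: Balaban1985Variational, Thm 1 (6),(8)–(10) pp.278–279, Prop. 7 p.299, Prop. 8 p.304, Prop. 9 p.309; Balaban1987RG1, Thm 1 p.259, (1.1)–(1.2) p.260, Thm 3 p.264] -/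
theorem record13SepCoPHInhabitedAx_of_sig8LR4Box_EU8_regClosure8_old_schemeNatural
    (h8 : ∀ F, Sig8LR4Box F)
    (hEU8 : ∀ F : T4Family, ∀ (c c₀ c₁ : ℕ) (B₃ aS a₁ : ℝ), 2 * (F.L : ℝ) ^ 2 ≤ B₃ → 0 < aS → 0 < a₁ →
        Prop8RegSepTopStepGB F 2 (fun ν K Ω => suppDomOfRecord F ν K Ω)
          (fun ν M g K k _s => c ≤ ν.M₁ ∧ k + c₀ ≤ F.m + K ∧ F.L ^ c₁ ∣ M ∧
            ∀ i, 1 ≤ i → i ≤ k → dCubeSide (F.P K).L M (RkOfRecord (F.P K).L ν.r (g i)) i ∣ (F.P K).sitesPerDir 0)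
          (lamDatum F) (dataSmall7LamTopOf F 2) B₃ aS a₁ →
        VariationalThm1EUSepCoP7MG F 2
          (fun ν M g K k _s => c ≤ ν.M₁ ∧ k + c₀ ≤ F.m + K ∧ F.L ^ c₁ ∣ M ∧
            ∀ i, 1 ≤ i → i ≤ k → dCubeSide (F.P K).L M (RkOfRecord (F.P K).L ν.r (g i)) i ∣ (F.P K).sitesPerDir 0) B₃ aS a₁)
    (hReg8 : ∀ F : T4Family, ∀ (c c₀ c₁ : ℕ) (B₃ aS a₁ : ℝ), 2 * (F.L : ℝ) ^ 2 ≤ B₃ → 0 < aS → 0 < a₁ →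
        Prop8RegSepTopStepGB F 2 (fun ν K Ω => suppDomOfRecord F ν K Ω)
          (fun ν M g K k _s => c ≤ ν.M₁ ∧ k + c₀ ≤ F.m + K ∧ F.L ^ c₁ ∣ M ∧
            ∀ i, 1 ≤ i → i ≤ k → dCubeSide (F.P K).L M (RkOfRecord (F.P K).L ν.r (g i)) i ∣ (F.P K).sitesPerDir 0)
          (lamDatum F) (dataSmall7LamTopOf F 2) B₃ aS a₁ →
        ∃ aR : ℝ, 0 < aR ∧ ∀ a₀ : ℝ, 0 < a₀ → a₀ ≤ aR → ∃ M₀ : ℕ, ∀ Mc : ℕ, McGuard F Mc → M₀ ≤ Mc →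
        ∀ ε₁ : ℝ, 0 < ε₁ → ε₁ ≤ a₁ → B₃ * ε₁ ≤ a₀ → ∀ (k n : ℕ) (V : GaugeField (F.P (recordK₀ F Mc k + n)) (k + 1) (SU 2)), PlaqSmall ε₁ V →
          ∀ U₃ : GaugeField (F.P (recordK₀ F Mc k + n)) 0 (SU 2),
            IsBackground (avOfRecord F 2 (recordK₀ F Mc k + n)) (closure (bgReg F 2 (recordK₀ F Mc k + n) (k + 1) a₀)) (k + 1) V U₃ →
            InUkClassB11 F 2 (recordK₀ F Mc k + n) (k + 1) a₀ U₃)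
    (hOld : ∀ F : T4Family,
      ∃ aT : ℝ, 0 < aT ∧ ∀ a₀ : ℝ, 0 < a₀ → a₀ ≤ aT → ∃ M₀ : ℕ, ∀ Mc : ℕ, McGuard F Mc → M₀ ≤ Mc → TokP9L4Old F Mc a₀)
    (hSch : ∀ F : T4Family,
      ∃ aS : ℝ, 0 < aS ∧ ∀ a₀ : ℝ, 0 < a₀ → a₀ ≤ aS → ∃ M₀ : ℕ, ∀ Mc : ℕ, McGuard F Mc → M₀ ≤ Mc → ∀ k n : ℕ,
        haveI := factL F; haveI := factEta F (recordK₀ F Mc k + n) (k + 1); haveI := factC0 F (recordK₀ F Mc k + n) (k + 1); haveI := wBRec_fact F (recordK₀ F Mc k + n) (k + 1);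
        ∃ (Ω : ℕ → Set (Site (F.P (recordK₀ F Mc k + n)) 0)) (dom : Set (GaugeField (F.P (recordK₀ F Mc k + n)) (k + 1) (SU 2))) (levB : PBond (F.P (recordK₀ F Mc k + n)) (k + 1) → ℕ)
          (Gp : SiteL2K ℂ (F.P (recordK₀ F Mc k + n)).d (fun _ => (F.P (recordK₀ F Mc k + n)).sitesPerDir 0) (c0Rec F (recordK₀ F Mc k + n) (k + 1)) (WRec 2) →ₗ[ℂ]
            SiteL2K ℂ (F.P (recordK₀ F Mc k + n)).d (fun _ => (F.P (recordK₀ F Mc k + n)).sitesPerDir 0) (c0Rec F (recordK₀ F Mc k + n) (k + 1)) (WRec 2))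
          (Δ2 : BondL2K ℂ (F.P (recordK₀ F Mc k + n)).d (fun _ => (F.P (recordK₀ F Mc k + n)).sitesPerDir 0) (c0Rec F (recordK₀ F Mc k + n) (k + 1)) (WRec 2) →ₗ[ℂ]
            BondL2K ℂ (F.P (recordK₀ F Mc k + n)).d (fun _ => (F.P (recordK₀ F Mc k + n)).sitesPerDir 0) (c0Rec F (recordK₀ F Mc k + n) (k + 1)) (WRec 2)) (a : ℝ)
          (hposπ : ∀ x, x ≠ 0 → 0 < RCLike.re ⟪x, laplaceAOfRecordAt F 2 (k + 1) (1 : GaugeField (F.P (recordK₀ F Mc k + n)) 0 (SU 2))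
            (hessOpOfRecord128 F 2 (k + 1) (1 : GaugeField (F.P (recordK₀ F Mc k + n)) 0 (SU 2)) Gp (QflatOfRecord F 2 (k + 1)) Δ2)
            (QOfRecord F 2 (k + 1) (1 : GaugeField (F.P (recordK₀ F Mc k + n)) 0 (SU 2))) (QflatOfRecord F 2 (k + 1)) a x⟫_ℂ)
          (hposb : ∀ x, x ≠ 0 → 0 < RCLike.re ⟪x, laplaceAOfRecord F 2 (k + 1) (1 : GaugeField (F.P (recordK₀ F Mc k + n)) 0 (SU 2))
            (QOfRecord F 2 (k + 1) (1 : GaugeField (F.P (recordK₀ F Mc k + n)) 0 (SU 2))) (QflatOfRecord F 2 (k + 1)) a x⟫_ℂ)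
          (hQ : Function.Surjective (QOfRecord F 2 (k + 1) (1 : GaugeField (F.P (recordK₀ F Mc k + n)) 0 (SU 2)))) (εC B₀ C₄ a₃ j a𝔄 ε₄ : ℝ)
          (S : BgSchemeOnLit F 2 (recordK₀ F Mc k + n) (k + 1) Ω 1)
          (_ : S = bgSchemeOfRecord F 2 (recordK₀ F Mc k + n) (k + 1) Ω 1 dom levB Gp Δ2 a hposπ hposb hQ εC B₀ C₄ a₃ j a𝔄 ε₄)
          (Kc : GaugeField (F.P (recordK₀ F Mc k + n)) (k + 1) (SU 2) → Set (Space115Lit F 2 (recordK₀ F Mc k + n) (k + 1) Ω 1)),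
          S.RegimeTok ∧ WAnalyticTok F 2 (recordK₀ F Mc k + n) (k + 1) Ω 1 levB Gp a hposb hQ εC a₃ ∧ 0 < a𝔄 ∧
          dom ∈ 𝓝 (1 : GaugeField (F.P (recordK₀ F Mc k + n)) (k + 1) (SU 2)) ∧
          (∀ V ∈ S.dom, ∀ A ∈ Kc V, S.chart V A ∈ bgReg F 2 (recordK₀ F Mc k + n) (k + 1) a₀ ∧ Averaging.iter (avOfRecord F 2 (recordK₀ F Mc k + n)) (k + 1) (S.chart V A) = V) ∧
          (∀ V ∈ S.dom, ∀ U : GaugeField (F.P (recordK₀ F Mc k + n)) 0 (SU 2), U ∈ bgReg F 2 (recordK₀ F Mc k + n) (k + 1) a₀ →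
            Averaging.iter (avOfRecord F 2 (recordK₀ F Mc k + n)) (k + 1) U = V → ∃ A ∈ Kc V, OrbitRel (k + 1) (S.chart V A) U) ∧
          (∀ V ∈ S.dom, ∀ A ∈ Kc V, IsMinOn (wilsonAction4 ∘ S.chart V) (Kc V) A →
            ‖A‖ ≤ S.ε₄ ∧ mapT (S.𝒢 V) 0 (S.W V) (S.J V) (S.𝔄 V) A = A) ∧
          (∀ V ∈ S.dom, S.sol V ∈ Kc V) ∧ (∀ V ∈ S.dom, IsMinOn (wilsonAction4 ∘ S.chart V) (Kc V) (S.sol V)) ∧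
          (∀ᶠ B in 𝓝 (0 : Fin (F.P (recordK₀ F Mc k + n)).d → Site (F.P (recordK₀ F Mc k + n)) (k + 1) → Fin (suChartDim 2) → ℝ),
            S.LieTokAt (readField F 2 (suOfMat 2) fun μ x => exp (suChartMap 2 (B μ x))))) :
    Summit.QuantumFields.YangMills.Theses.BalabanUVNodes.Record13SepCoPHInhabitedAx :=
  record13SepCoPHInhabitedAx_of_sig8LR4Box_uk8_old_schemeNatural h8 (fun F => residualUk8_of_residualEU8_regClosure8 F (hEU8 F) (hReg8 F)) hOld hSch

/-! ## §3  ★★★ THE JUNCTION's BINDER `hβc` RE-KEYED: ⟸ cofinal ⁸ ∧ (R-EU⁸) ∧ (R-Reḡ⁸) ∧ (R-Old) ∧ (R-Sch♮) ∧ (R-Win₁) (✓№22 :245 with `hUk := §1`) -/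

/-- ★★★ **THE JUNCTION's BINDER `hβc` VERBATIM ⟸ cofinal ⁸ ∧ (R-EU⁸) ∧ (R-Reḡ⁸) ∧ (R-Old) ∧ (R-Sch♮) ∧ (R-Win₁)**:
✓`cofinalBetaSocketAxBody_allRadii_of_sig8LR4BoxCofinal_uk8_old_schemeNatural_winC` with its (R-Uk⁸) binder supplied by §1.  CONDITIONAL; every hypothesis
OPEN Bałaban-strength content inhabited NOWHERE; K0ᴬ 27238, K1ᴬ 27239 OPEN; NODE O 0∕1; the Yang–Mills mass gap is NOT proved.
[cite: Balaban1987RG1, Thm 2 (0.31) p.259, Thm 3 p.264, (5.38)–(5.44) pp.296–297; Balaban1985Variational, Thm 1 (6),(8)–(10) pp.278–279, Prop. 7 p.299, Prop. 8 p.304] -/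
theorem cofinalBetaSocketAxBody_allRadii_of_sig8LR4BoxCofinal_EU8_regClosure8_old_schemeNatural_winC
    (h8c : ∀ (F : T4Family) (εw : ℝ), 0 < εw → Sig8LR4BoxBelow F εw)
    (hEU8 : ∀ F : T4Family, ∀ (c c₀ c₁ : ℕ) (B₃ aS a₁ : ℝ), 2 * (F.L : ℝ) ^ 2 ≤ B₃ → 0 < aS → 0 < a₁ →
        Prop8RegSepTopStepGB F 2 (fun ν K Ω => suppDomOfRecord F ν K Ω)
          (fun ν M g K k _s => c ≤ ν.M₁ ∧ k + c₀ ≤ F.m + K ∧ F.L ^ c₁ ∣ M ∧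
            ∀ i, 1 ≤ i → i ≤ k → dCubeSide (F.P K).L M (RkOfRecord (F.P K).L ν.r (g i)) i ∣ (F.P K).sitesPerDir 0)
          (lamDatum F) (dataSmall7LamTopOf F 2) B₃ aS a₁ →
        VariationalThm1EUSepCoP7MG F 2
          (fun ν M g K k _s => c ≤ ν.M₁ ∧ k + c₀ ≤ F.m + K ∧ F.L ^ c₁ ∣ M ∧
            ∀ i, 1 ≤ i → i ≤ k → dCubeSide (F.P K).L M (RkOfRecord (F.P K).L ν.r (g i)) i ∣ (F.P K).sitesPerDir 0) B₃ aS a₁)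
    (hReg8 : ∀ F : T4Family, ∀ (c c₀ c₁ : ℕ) (B₃ aS a₁ : ℝ), 2 * (F.L : ℝ) ^ 2 ≤ B₃ → 0 < aS → 0 < a₁ →
        Prop8RegSepTopStepGB F 2 (fun ν K Ω => suppDomOfRecord F ν K Ω)
          (fun ν M g K k _s => c ≤ ν.M₁ ∧ k + c₀ ≤ F.m + K ∧ F.L ^ c₁ ∣ M ∧
            ∀ i, 1 ≤ i → i ≤ k → dCubeSide (F.P K).L M (RkOfRecord (F.P K).L ν.r (g i)) i ∣ (F.P K).sitesPerDir 0)
          (lamDatum F) (dataSmall7LamTopOf F 2) B₃ aS a₁ →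
        ∃ aR : ℝ, 0 < aR ∧ ∀ a₀ : ℝ, 0 < a₀ → a₀ ≤ aR → ∃ M₀ : ℕ, ∀ Mc : ℕ, McGuard F Mc → M₀ ≤ Mc →
        ∀ ε₁ : ℝ, 0 < ε₁ → ε₁ ≤ a₁ → B₃ * ε₁ ≤ a₀ → ∀ (k n : ℕ) (V : GaugeField (F.P (recordK₀ F Mc k + n)) (k + 1) (SU 2)), PlaqSmall ε₁ V →
          ∀ U₃ : GaugeField (F.P (recordK₀ F Mc k + n)) 0 (SU 2),
            IsBackground (avOfRecord F 2 (recordK₀ F Mc k + n)) (closure (bgReg F 2 (recordK₀ F Mc k + n) (k + 1) a₀)) (k + 1) V U₃ →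
            InUkClassB11 F 2 (recordK₀ F Mc k + n) (k + 1) a₀ U₃)
    (hOld : ∀ F : T4Family,
      ∃ aT : ℝ, 0 < aT ∧ ∀ a₀ : ℝ, 0 < a₀ → a₀ ≤ aT → ∃ M₀ : ℕ, ∀ Mc : ℕ, McGuard F Mc → M₀ ≤ Mc → TokP9L4Old F Mc a₀)
    (hSch : ∀ F : T4Family,
      ∃ aS : ℝ, 0 < aS ∧ ∀ a₀ : ℝ, 0 < a₀ → a₀ ≤ aS → ∃ M₀ : ℕ, ∀ Mc : ℕ, McGuard F Mc → M₀ ≤ Mc → ∀ k n : ℕ,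
        haveI := factL F; haveI := factEta F (recordK₀ F Mc k + n) (k + 1); haveI := factC0 F (recordK₀ F Mc k + n) (k + 1); haveI := wBRec_fact F (recordK₀ F Mc k + n) (k + 1);
        ∃ (Ω : ℕ → Set (Site (F.P (recordK₀ F Mc k + n)) 0)) (dom : Set (GaugeField (F.P (recordK₀ F Mc k + n)) (k + 1) (SU 2))) (levB : PBond (F.P (recordK₀ F Mc k + n)) (k + 1) → ℕ)
          (Gp : SiteL2K ℂ (F.P (recordK₀ F Mc k + n)).d (fun _ => (F.P (recordK₀ F Mc k + n)).sitesPerDir 0) (c0Rec F (recordK₀ F Mc k + n) (k + 1)) (WRec 2) →ₗ[ℂ]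
            SiteL2K ℂ (F.P (recordK₀ F Mc k + n)).d (fun _ => (F.P (recordK₀ F Mc k + n)).sitesPerDir 0) (c0Rec F (recordK₀ F Mc k + n) (k + 1)) (WRec 2))
          (Δ2 : BondL2K ℂ (F.P (recordK₀ F Mc k + n)).d (fun _ => (F.P (recordK₀ F Mc k + n)).sitesPerDir 0) (c0Rec F (recordK₀ F Mc k + n) (k + 1)) (WRec 2) →ₗ[ℂ]
            BondL2K ℂ (F.P (recordK₀ F Mc k + n)).d (fun _ => (F.P (recordK₀ F Mc k + n)).sitesPerDir 0) (c0Rec F (recordK₀ F Mc k + n) (k + 1)) (WRec 2)) (a : ℝ)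
          (hposπ : ∀ x, x ≠ 0 → 0 < RCLike.re ⟪x, laplaceAOfRecordAt F 2 (k + 1) (1 : GaugeField (F.P (recordK₀ F Mc k + n)) 0 (SU 2))
            (hessOpOfRecord128 F 2 (k + 1) (1 : GaugeField (F.P (recordK₀ F Mc k + n)) 0 (SU 2)) Gp (QflatOfRecord F 2 (k + 1)) Δ2)
            (QOfRecord F 2 (k + 1) (1 : GaugeField (F.P (recordK₀ F Mc k + n)) 0 (SU 2))) (QflatOfRecord F 2 (k + 1)) a x⟫_ℂ)
          (hposb : ∀ x, x ≠ 0 → 0 < RCLike.re ⟪x, laplaceAOfRecord F 2 (k + 1) (1 : GaugeField (F.P (recordK₀ F Mc k + n)) 0 (SU 2))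
            (QOfRecord F 2 (k + 1) (1 : GaugeField (F.P (recordK₀ F Mc k + n)) 0 (SU 2))) (QflatOfRecord F 2 (k + 1)) a x⟫_ℂ)
          (hQ : Function.Surjective (QOfRecord F 2 (k + 1) (1 : GaugeField (F.P (recordK₀ F Mc k + n)) 0 (SU 2)))) (εC B₀ C₄ a₃ j a𝔄 ε₄ : ℝ)
          (S : BgSchemeOnLit F 2 (recordK₀ F Mc k + n) (k + 1) Ω 1)
          (_ : S = bgSchemeOfRecord F 2 (recordK₀ F Mc k + n) (k + 1) Ω 1 dom levB Gp Δ2 a hposπ hposb hQ εC B₀ C₄ a₃ j a𝔄 ε₄)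
          (Kc : GaugeField (F.P (recordK₀ F Mc k + n)) (k + 1) (SU 2) → Set (Space115Lit F 2 (recordK₀ F Mc k + n) (k + 1) Ω 1)),
          S.RegimeTok ∧ WAnalyticTok F 2 (recordK₀ F Mc k + n) (k + 1) Ω 1 levB Gp a hposb hQ εC a₃ ∧ 0 < a𝔄 ∧
          dom ∈ 𝓝 (1 : GaugeField (F.P (recordK₀ F Mc k + n)) (k + 1) (SU 2)) ∧
          (∀ V ∈ S.dom, ∀ A ∈ Kc V, S.chart V A ∈ bgReg F 2 (recordK₀ F Mc k + n) (k + 1) a₀ ∧ Averaging.iter (avOfRecord F 2 (recordK₀ F Mc k + n)) (k + 1) (S.chart V A) = V) ∧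
          (∀ V ∈ S.dom, ∀ U : GaugeField (F.P (recordK₀ F Mc k + n)) 0 (SU 2), U ∈ bgReg F 2 (recordK₀ F Mc k + n) (k + 1) a₀ →
            Averaging.iter (avOfRecord F 2 (recordK₀ F Mc k + n)) (k + 1) U = V → ∃ A ∈ Kc V, OrbitRel (k + 1) (S.chart V A) U) ∧
          (∀ V ∈ S.dom, ∀ A ∈ Kc V, IsMinOn (wilsonAction4 ∘ S.chart V) (Kc V) A →
            ‖A‖ ≤ S.ε₄ ∧ mapT (S.𝒢 V) 0 (S.W V) (S.J V) (S.𝔄 V) A = A) ∧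
          (∀ V ∈ S.dom, S.sol V ∈ Kc V) ∧ (∀ V ∈ S.dom, IsMinOn (wilsonAction4 ∘ S.chart V) (Kc V) (S.sol V)) ∧
          (∀ᶠ B in 𝓝 (0 : Fin (F.P (recordK₀ F Mc k + n)).d → Site (F.P (recordK₀ F Mc k + n)) (k + 1) → Fin (suChartDim 2) → ℝ),
            S.LieTokAt (readField F 2 (suOfMat 2) fun μ x => exp (suChartMap 2 (B μ x)))))
    (hWinC : ∀ F : T4Family,
      ∃ aW : ℝ, 0 < aW ∧ ∀ a₀ : ℝ, 0 < a₀ → a₀ ≤ aW → ∃ εw γw : ℝ, 0 < εw ∧ 0 < γw ∧ γw ≤ 1 / 2 ∧ ∀ ε₂₉ : ℝ, 0 < ε₂₉ → ε₂₉ ≤ εw →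
        (letI θ := thetaFill F a₀ ε₂₉; letI := θ.instVβ₁; letI := θ.instVβ₂; letI := θ.instιβ;
         (∀ k K : ℕ, ContinuousOn (fun v : Fin (k + 1) → ℝ => fderiv ℝ (fderiv ℝ (B12PolarizationTensor120.expChart (recordTermsAx F a₀ ε₂₉ k v K) θ.ρ8)) 0) (FlowStep.Box γw k))) ∧
         ∃ e : ℕ → ℝ, RecordPlimMomentNegPartOnBoxAx F a₀ ε₂₉ γw e) :
    ∀ F : T4Family, ∀ a : ℝ, 0 < a → CofinalBetaSocketAxBody F a :=
  cofinalBetaSocketAxBody_allRadii_of_sig8LR4BoxCofinal_uk8_old_schemeNatural_winC h8c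
    (fun F => residualUk8_of_residualEU8_regClosure8 F (hEU8 F) (hReg8 F)) hOld hSch hWinC

end Summit.QuantumFields.YangMills.Theorems.K0AxJoinResidualBoxUk8EU
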